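import Summits.QuantumFields.QCD.Theorems.PauliWegnerSeaFMClosureUnquenchedRepairedC2

/-!
# Crux `FMClosureUnquenched` (stmt-QuantumFields-11512), line `von-mises-circles`, lead c2:
the closure for the input AS TYPED (`1 ≤ ℓ₀`) under a coupling floor `β₀ ≤ |β_k|`

Companion of `Theorems/PauliWegnerSeaFMClosureUnquenchedRepairedC2.lean`.  The unit-shell corner A5 of the crux as typed is
`ℓ₀ = 1 ∧ β_k → 0`; it is equally removed by keeping the one-scale input VERBATIM (`1 ≤ ℓ₀`) and asking instead that the
couplings stay away from zero, `∃ β₀ > 0, ∀ᶠ k, β₀ ≤ |β_k|` — automatic for every asymptotically free regularisation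
(`β_k → ∞`), so this variant costs the trajectory item nothing and leaves the shared one-scale-input text untouched.

1. `closure_from_betaFloor` — `TwoStarBounds → FarStability → CollarResolventBounds → HoppingDecay → (∃ β₀ > 0, ∀ᶠ k,
   β₀ ≤ |β_k|) → Input → OutwardDecayWith` (same proof as `VonMisesCirclesC1.stub_closure` / `closure_from_two` with the size
   threshold `Θ = min 2 (1 + β₀) ≤ ℓ₀ (1 + |β_k|)` read off the coupling floor).
2. `outward_of_localCofactorDomination_farStability_betaFloor` — K1♭ → (∀ N_f, FarStability N_f) → coupling floor → Input →
   OutwardDecayWith, every regularisation and mass tuple.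
3. `coreOutward_of_localCofactorDomination_farStability_betaFloor` — the same with hypothesis = the crux's one-scale input
   VERBATIM and conclusion = clause (ii) OUTWARD (for `K (1 + |log a_k|) ≤ a_k ‖v‖`), integrands byte-identical with the route.
4. `tendsto_afBeta_atTop`, `tendsto_beta_atTop_of_hasAsymptoticScaling`, `betaFloor_of_hasAsymptoticScaling` — for `N_f ≤ 16`
   the two-loop profile diverges and `HasAsymptoticScaling` of any scheme of `reg` forces `β_k → +∞`, hence the coupling
   floor (`β₀ = 1`): the assembly discharges the extra hypothesis from `(Chiral)OneScaleTrajectory`'s asymptotic scaling.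

References: Aizenman–Schenker–Friedrich–Hundertmark, CMP 224 (2001) 219, §2 and Thm 2 [AizenmanEtAl2001].
-/

noncomputable section

open scoped BigOperators
open MeasureTheory Filter Topology
open Literature.MathematicalPhysics.QuantumFieldTheory Literature.MathematicalPhysics.QuantumLattice
  Literature.Probability.LatticeModels
open Summit.QuantumFields.QCD.Theorems.VonMisesCircles
open Summit.QuantumFields.QCD.Theorems.VonMisesCirclesC1

namespace Summit.QuantumFields.QCD.Theorems.VonMisesCirclesC2

/-! ## 1. The closure under a coupling floor -/

/-- **The closure of crux stmt-QuantumFields-11512 under a coupling floor** (line `von-mises-circles`, lead c2): for every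
regularisation whose couplings eventually satisfy `β₀ ≤ |β_k|` (`β₀ > 0`) and every mass tuple, the two-star bounds, far
stability, the collar resolvent bounds and the hopping decay turn the crux's one-scale input AS TYPED (`1 ≤ ℓ₀`) into the
outward decay package `OutwardDecayWith`.  Size threshold `Θ = min 2 (1 + β₀) ≤ ℓ₀ (1 + |β_k|)`.
[cite: AizenmanEtAl2001, §2 and Thm 2] -/
theorem closure_from_betaFloor :
    ∀ (Nf : ℕ) (reg : QCDRegularisation Nf) (m : Fin Nf → ℝ),
      TwoStarBounds Nf → FarStability Nf → CollarResolventBounds → HoppingDecay Nf →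
        (∃ β₀ : ℝ, 0 < β₀ ∧ ∀ᶠ k in atTop, β₀ ≤ |reg.β k|) → Input Nf reg m →
          ∃ (s δ C K₀ : ℝ) (ℓ₀ : ℕ → Fin Nf → ℕ), OutwardDecayWith Nf reg m s δ C K₀ ℓ₀ := by
  intro Nf reg m hTS hFS hCR hHD hβfloor hIn
  obtain ⟨β₀, hβ₀, hβ⟩ := hβfloor
  classical
  obtain ⟨s₀, C, p, hs₀, _hs₀1, hC, hT⟩ := hTS
  obtain ⟨s₀', Cf, pf, θ, hs₀', _hs₀'1, hCf, hθ0, hθ1, hF⟩ := hFS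
  obtain ⟨CH, μ, hCH, hμ, hH⟩ := hHD
  obtain ⟨C₁, c₁, Cb, cb, CM, cM, hC₁, hc₁, hCb, hcb, hCM, hcM, hboot⟩ :=
    c1_volume_bootstrap hC hCf hθ0 hθ1 hT hF hCR
  -- exponent floor `σ` and size threshold `Θ = min 2 (1 + β₀)`
  obtain ⟨σ, hσ0, hσs₀, hσs₀', hσ12⟩ : ∃ σ : ℝ, 0 < σ ∧ σ ≤ s₀ ∧ σ ≤ s₀' ∧ σ ≤ 1 / 2 :=
    ⟨min (min s₀ s₀') (1 / 2), lt_min (lt_min hs₀ hs₀') (by norm_num),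
      (min_le_left _ _).trans (min_le_left _ _), (min_le_left _ _).trans (min_le_right _ _), min_le_right _ _⟩
  obtain ⟨Θ, hΘ1, hΘ2, hΘβ⟩ : ∃ Θ : ℝ, 1 < Θ ∧ Θ ≤ 2 ∧ Θ ≤ 1 + β₀ :=
    ⟨min 2 (1 + β₀), lt_min (by norm_num) (by linarith), min_le_left _ _, min_le_right _ _⟩
  have hΘ0 : 0 < Θ := by linarith
  have hlogΘ : 0 < Real.log Θ := Real.log_pos hΘ1
  -- choice of `q`
  set A : ℝ := max (2 * Cb) (CM * Cb) with hA
  have hA2 : 2 * Cb ≤ A := le_max_left _ _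
  have hAM : CM * Cb ≤ A := le_max_right _ _
  have hA1 : 1 ≤ A := by linarith
  have hA0 : 0 < A := by linarith
  have hLA : 0 ≤ Real.log A / Real.log Θ := div_nonneg (Real.log_nonneg hA1) hlogΘ.le
  obtain ⟨q, hq⟩ := c1_exists_nat_mul_ge (θ * σ) (c₁ + cb + cM + 1 + Real.log A / Real.log Θ) (by positivity)
  set κ : ℝ := (q : ℝ) * σ with hκ
  have hκ0 : 0 ≤ κ := by positivity
  have hθκ : c₁ + cb + cM + 1 + Real.log A / Real.log Θ ≤ θ * κ := by rw [hκ]; linarith [hq]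
  have hθκκ : θ * κ ≤ κ := by nlinarith
  have hQ1 : c₁ < κ := by linarith
  have hQ2 : cb < θ * κ := by linarith
  have hΘA : ∀ e : ℝ, e ≤ -(Real.log A / Real.log Θ) → Θ ^ e ≤ A⁻¹ := fun e he =>
    (Real.rpow_le_rpow_of_exponent_le hΘ1.le he).trans_eq (c1_rpow_neg_log_div Θ A hΘ1 hA0)
  have hQ3 : Cb * Θ ^ (cb - θ * κ) ≤ 1 / 2 := by
    have h1 : Θ ^ (cb - θ * κ) ≤ A⁻¹ := hΘA _ (by linarith)
    calc Cb * Θ ^ (cb - θ * κ) ≤ Cb * A⁻¹ := mul_le_mul_of_nonneg_left h1 (by linarith)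
      _ ≤ Cb * (2 * Cb)⁻¹ := mul_le_mul_of_nonneg_left (inv_anti₀ (by linarith) hA2) (by linarith)
      _ = 1 / 2 := by field_simp
  have hQ4 : CM * Cb * Θ ^ (cM + cb - θ * κ) ≤ 1 := by
    have h1 : Θ ^ (cM + cb - θ * κ) ≤ A⁻¹ := hΘA _ (by linarith)
    calc CM * Cb * Θ ^ (cM + cb - θ * κ) ≤ CM * Cb * A⁻¹ := mul_le_mul_of_nonneg_left h1 (by positivity)
      _ ≤ A * A⁻¹ := mul_le_mul_of_nonneg_right hAM (inv_nonneg.2 hA0.le)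
      _ = 1 := mul_inv_cancel₀ hA0.ne'
  -- the input at this `q`
  obtain ⟨K₀, sq, hsq0, hsq1, hev⟩ := hIn q
  -- the exponent
  set t : ℝ := min σ sq with ht
  have ht0 : 0 < t := lt_min hσ0 hsq0
  have htσ : t ≤ σ := min_le_left _ _
  have htsq : t ≤ sq := min_le_right _ _
  have ht1 : t ≤ 1 := by linarith
  have ht1' : t < 1 := by linarith
  have hts : t ≤ s₀ := htσ.trans hσs₀
  have hts' : t ≤ s₀' := htσ.trans hσs₀'
  have hσts : σ ≤ t / sq := by
    rw [le_div_iff₀ hsq0, ht]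
    rcases le_total σ sq with h | h
    · rw [min_eq_left h]; nlinarith
    · rw [min_eq_right h]; nlinarith
  -- `K₀ > 0` (the input is non-vacuous at some step)
  have hK₀ : 0 < K₀ := by
    obtain ⟨k, ℓ₀, hℓ1, -, hℓK, -⟩ := hev.exists
    have h1 : (0 : ℝ) < ℓ₀ * reg.a k := mul_pos (by exact_mod_cast hℓ1) (reg.a_pos k)
    have h2 : (0 : ℝ) < 1 + |Real.log (reg.a k)| := by positivity
    by_contra hK
    push Not at hK
    have : K₀ * (1 + |Real.log (reg.a k)|) ≤ 0 := mul_nonpos_of_nonpos_of_nonneg hK h2.le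
    linarith
  -- the rate arithmetic
  obtain ⟨δ, Cr, a₀, hδ, hCr, ha₀, hrate⟩ := c1_closure_rate Θ K₀ C₁ c₁ Cb cb θ κ hΘ1 hK₀ hC₁ hCb hQ1 hQ2
  -- the input radius as a function of the step
  let P : ℕ → ℕ → Prop := fun k ℓ₀ => 1 ≤ ℓ₀ ∧ ℓ₀ ≤ reg.L k ∧
    (ℓ₀ : ℝ) * reg.a k ≤ K₀ * (1 + |Real.log (reg.a k)|) ∧
    ∀ S : ℕ, reg.L k ≤ S → ∀ (f : Fin Nf) (v : Site 4), v ∈ box 4 S → ‖v‖ = (ℓ₀ : ℝ) →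
      (ℓ₀ : ℝ) ^ q * (1 + |reg.β k|) ^ q * cruxMoment Nf (reg.β k) (bareMass reg m k) S f v sq ≤ 1
  let ℓf : ℕ → ℕ := fun k => if h : ∃ ℓ₀, P k ℓ₀ then h.choose else 0
  have hℓf : ∀ k, (∃ ℓ₀, P k ℓ₀) → P k (ℓf k) := fun k h => by
    simp only [ℓf, dif_pos h]
    exact h.choose_spec
  -- eventual smallness of the spacing
  have hev_a₀ : ∀ᶠ k in atTop, reg.a k ≤ a₀ := reg.tendsto_a.eventually_le_const ha₀
  have hev_hop : ∀ᶠ k in atTop, reg.a k ≤ μ * t / δ := reg.tendsto_a.eventually_le_const (by positivity)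
  -- the package
  refine ⟨t, δ, max Cr CH, K₀, fun k _ => ℓf k, ht0, ht1', hδ, hCr.trans (le_max_left _ _), ?_, ?_, ?_⟩
  · filter_upwards [hev] with k hk f
    exact (hℓf k hk).2.2.1
  · filter_upwards [hev] with k hk f
    exact (hℓf k hk).2.1
  filter_upwards [hev, hev_a₀, hev_hop, hβ] with k hk hka hkh hkβ S hS f v hv hℓv
  obtain ⟨hℓ1, hℓL, hℓK, hshellIn⟩ := hℓf k hk
  change ((ℓf k : ℕ) : ℝ) ≤ ‖v‖ at hℓv
  set ℓ₀ : ℕ := ℓf k with hℓ₀def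
  have hmax0 : 0 ≤ max Cr CH := hCr.trans (le_max_left _ _)
  have hexp : ∀ x : ℝ, 0 ≤ Real.exp x := fun x => (Real.exp_pos x).le
  by_cases hhop : (41 / 10 : ℝ) ≤ |bareMass reg m k f + 4|
  · -- the hopping window
    have h := hH (reg.β k) (bareMass reg m k) f hhop S t ht0 ht1' v hv
    change cruxMoment Nf (reg.β k) (bareMass reg m k) S f v t ≤ CH * Real.exp (-(μ * t * ‖v‖)) at h
    refine h.trans (mul_le_mul (le_max_right _ _) (Real.exp_le_exp.2 (neg_le_neg ?_)) (hexp _) hmax0)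
    have h1 : δ * reg.a k ≤ μ * t := by rwa [le_div_iff₀ hδ, mul_comm] at hkh
    calc δ * (reg.a k * ‖v‖) = (δ * reg.a k) * ‖v‖ := by ring
      _ ≤ μ * t * ‖v‖ := mul_le_mul_of_nonneg_right h1 (norm_nonneg _)
  · -- outside the hopping window: the bootstrap
    have habs : |bareMass reg m k f + 4| < 41 / 10 := lt_of_not_ge hhop
    obtain ⟨hlo, hhi⟩ := abs_lt.1 habs
    have hm9 : -9 ≤ bareMass reg m k f := by linarith only [hlo]
    have hm1 : bareMass reg m k f ≤ 1 := by linarith only [hhi]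
    have hβ1 : 1 ≤ 1 + |reg.β k| := by have := abs_nonneg (reg.β k); linarith only [this]
    have hℓ1r : (1 : ℝ) ≤ ℓ₀ := by exact_mod_cast hℓ1
    set Θk : ℝ := (ℓ₀ : ℝ) * (1 + |reg.β k|) with hΘk
    have hℓΘ : (ℓ₀ : ℝ) ≤ Θk := by rw [hΘk]; exact le_mul_of_one_le_right (Nat.cast_nonneg _) hβ1
    -- the size threshold is met because `β₀ ≤ |β_k|` (no `β_k → 0` corner)
    have hΘΘk : Θ ≤ Θk := by
      have h1 : 1 + β₀ ≤ 1 + |reg.β k| := by linarith only [hkβ]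
      have h2 : 1 + |reg.β k| ≤ Θk := by
        rw [hΘk]; exact le_mul_of_one_le_left (by linarith only [hβ1]) hℓ1r
      exact hΘβ.trans (h1.trans h2)
    have hΘk1 : 1 ≤ Θk := hΘ1.le.trans hΘΘk
    have hΘk0 : 0 < Θk := by linarith only [hΘk1]
    -- the shell input at exponent `t`
    have hshell : ∀ w : Site 4, w ∈ box 4 S → ‖w‖ = (ℓ₀ : ℝ) →
        pqE Nf S (reg.β k) (bareMass reg m k) (fun U => blockNorm (wilsonD U (bareMass reg m k f))⁻¹ 0
          (Torus.proj (2 * S + 1) w) ^ t) ≤ ((ℓ₀ : ℝ) * (1 + |reg.β k|)) ^ (-κ) := by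
      intro w hw hwn
      have h := c1_shell_lower (reg.β k) (bareMass reg m k) S f w q ℓ₀ ht0 htsq hsq1.le hσts hℓ1
        (hshellIn S hS f w hw hwn)
      rwa [c1_cruxMoment_eq_pqE, c1_proj_zero] at h
    obtain ⟨hB1, hB2⟩ := hboot (reg.β k) t (bareMass reg m k) f S ℓ₀ κ ht0 ht1 hts hts' hm9 hm1 hℓ1
      (hℓL.trans hS) hκ0 hshell
    -- the quantity, the distance
    have hE : cruxMoment Nf (reg.β k) (bareMass reg m k) S f v t =
        pqE Nf S (reg.β k) (bareMass reg m k) (fun U => blockNorm (wilsonD U (bareMass reg m k f))⁻¹ 0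
          (Torus.proj (2 * S + 1) v) ^ t) := by
      rw [c1_cruxMoment_eq_pqE, c1_proj_zero]
    have hnorm : ‖v‖ = (Site.supNorm v : ℝ) := c1_norm_eq_supNorm v
    have hn : ℓ₀ ≤ Site.supNorm v := by
      have : (ℓ₀ : ℝ) ≤ Site.supNorm v := by rw [← hnorm]; exact hℓv
      exact_mod_cast this
    have hvS : Site.supNorm v ≤ S := mem_box_iff_supNorm_le.1 hv
    -- the rate-free bound
    have hrf : cruxMoment Nf (reg.β k) (bareMass reg m k) S f v t ≤ C₁ * Θk ^ (c₁ - κ) := by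
      rw [hE]; exact hB1 v hv hn
    -- monotonicity in the size parameter
    have hmono : ∀ e : ℝ, e ≤ 0 → Θk ^ e ≤ Θ ^ e := fun e he => Real.rpow_le_rpow_of_nonpos hΘ0 hΘΘk he
    have hbsmall : Cb * Θk ^ (cb - θ * κ) ≤ 1 / 2 :=
      (mul_le_mul_of_nonneg_left (hmono _ (by linarith only [hQ2])) (by linarith only [hCb])).trans hQ3
    -- conclusion through the rate arithmetic
    suffices hfin : cruxMoment Nf (reg.β k) (bareMass reg m k) S f v t ≤
        Cr * Real.exp (-(δ * (reg.a k * (Site.supNorm v : ℕ)))) by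
      rw [hnorm]
      exact hfin.trans (mul_le_mul_of_nonneg_right (le_max_left _ _) (hexp _))
    by_cases hfar : 4 * (3 * ℓ₀ + 4) ≤ Site.supNorm v
    · -- far: the collar bound is available
      have hfit : 3 * ℓ₀ + 4 ≤ S := by omega
      obtain ⟨b, M, hb0, hb, hM0, hM, hEb⟩ := hB2 hfit (hbsmall.trans (by norm_num)) v hv
      refine hrate (reg.a k) Θk b M _ ℓ₀ (Site.supNorm v) (reg.a_pos k) hka hℓ1 hΘΘk hℓΘ hℓK hn hrf ?_
      intro _
      refine ⟨hb0, hb.trans hbsmall, hb, hM0, ?_, by rw [hE]; exact hEb⟩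
      -- `M b ≤ 1`
      have h1 : M * b ≤ (CM * Θk ^ cM) * (Cb * Θk ^ (cb - θ * κ)) := mul_le_mul hM hb hb0 (by positivity)
      have h2 : (CM * Θk ^ cM) * (Cb * Θk ^ (cb - θ * κ)) = CM * Cb * Θk ^ (cM + cb - θ * κ) := by
        rw [show cM + cb - θ * κ = cM + (cb - θ * κ) by ring, Real.rpow_add hΘk0]; ring
      have h3 : CM * Cb * Θk ^ (cM + cb - θ * κ) ≤ CM * Cb * Θ ^ (cM + cb - θ * κ) :=
        mul_le_mul_of_nonneg_left (hmono _ (by linarith only [hθκ, hc₁, hLA])) (mul_nonneg hCM (by linarith only [hCb]))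
      linarith only [h1, h2, h3, hQ4]
    · -- near: only the rate-free bound is needed
      exact hrate (reg.a k) Θk 0 0 _ ℓ₀ (Site.supNorm v) (reg.a_pos k) hka hℓ1 hΘΘk hℓΘ hℓK hn hrf
        (fun h => absurd h hfar)


/-! ## 2. K1♭ → FarStability → the outward package for the input as typed, under a coupling floor -/

/-- **K1♭ and far stability give the outward package for the crux's input AS TYPED under a coupling floor**:
`LocalCofactorDomination → (∀ N_f, FarStability N_f) → ∀ N_f reg m, (∃ β₀ > 0, ∀ᶠ k, β₀ ≤ |β_k|) → Input → ∃ …,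
OutwardDecayWith …`. [cite: AizenmanEtAl2001, Thm 2] -/
theorem outward_of_localCofactorDomination_farStability_betaFloor (hK : LocalCofactorDomination)
    (hF : ∀ Nf : ℕ, FarStability Nf) :
    ∀ (Nf : ℕ) (reg : QCDRegularisation Nf) (m : Fin Nf → ℝ),
      (∃ β₀ : ℝ, 0 < β₀ ∧ ∀ᶠ k in atTop, β₀ ≤ |reg.β k|) → Input Nf reg m →
        ∃ (s δ C K₀ : ℝ) (ℓ₀ : ℕ → Fin Nf → ℕ), OutwardDecayWith Nf reg m s δ C K₀ ℓ₀ :=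
  fun Nf reg m hβ hIn =>
    closure_from_betaFloor Nf reg m (twoStarBounds_of_localCofactorDomination hK Nf) (hF Nf)
      collarResolventBounds_holds (hoppingDecay_holds Nf) hβ hIn

/-- **The outward core of K2 for the input AS TYPED, closed modulo K1♭ and far stability, under a coupling floor** —
hypothesis = the crux's one-scale input VERBATIM (`1 ≤ ℓ₀`), conclusion = clause (ii) OUTWARD (for
`K (1 + |log a_k|) ≤ a_k ‖v‖`), integrands byte-identical with `FMClosureUnquenched`; the only addition is
`∃ β₀ > 0, ∀ᶠ k, β₀ ≤ |β_k|` (automatic when `β_k → ∞`). [cite: AizenmanEtAl2001, Thm 2] -/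
theorem coreOutward_of_localCofactorDomination_farStability_betaFloor (hK : LocalCofactorDomination)
    (hF : ∀ Nf : ℕ, FarStability Nf) :
    ∀ (Nf : ℕ) (reg : QCDRegularisation Nf) (m : Fin Nf → ℝ),
      (∃ β₀ : ℝ, 0 < β₀ ∧ ∀ᶠ k in atTop, β₀ ≤ |reg.β k|) →
      (∀ q : ℕ, ∃ K₀ s : ℝ, 0 < s ∧ s < 1 ∧ ∀ᶠ k in atTop, ∃ ℓ₀ : ℕ, 1 ≤ ℓ₀ ∧ ℓ₀ ≤ reg.L k ∧
        (ℓ₀ : ℝ) * reg.a k ≤ K₀ * (1 + |Real.log (reg.a k)|) ∧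
        ∀ S : ℕ, reg.L k ≤ S → ∀ (f : Fin Nf) (v : Literature.Probability.LatticeModels.Site 4),
          v ∈ box 4 S → ‖v‖ = (ℓ₀ : ℝ) →
            (ℓ₀ : ℝ) ^ q * (1 + |reg.β k|) ^ q *
              ((∫ U : GaugeConfig 4 (2 * S + 1) (Matrix.specialUnitaryGroup (Fin 3) ℂ),
                  ‖(diracMatrix U fun fl => reg.mcrit k + reg.a k * m fl / reg.Zm k).det‖ *
                    (∑ a : Fin 3, ∑ i : Fin 4, ∑ b : Fin 3, ∑ j : Fin 4,
                      ‖(diracMatrix U fun fl => reg.mcrit k + reg.a k * m fl / reg.Zm k)⁻¹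
                        (quarkEquiv (f, (Torus.proj (2 * S + 1) 0, a, i)))
                        (quarkEquiv (f, (Torus.proj (2 * S + 1) (v), b, j)))‖) ^ s
                  ∂(wilsonMeasure (fundamentalRep (Fin 3)) (reg.β k))) /
                (∫ U : GaugeConfig 4 (2 * S + 1) (Matrix.specialUnitaryGroup (Fin 3) ℂ),
                  ‖(diracMatrix U fun fl => reg.mcrit k + reg.a k * m fl / reg.Zm k).det‖
                  ∂(wilsonMeasure (fundamentalRep (Fin 3)) (reg.β k)))) ≤ 1) →
      ∃ s δ C K : ℝ, 0 < s ∧ s < 1 ∧ 0 < δ ∧ ∀ᶠ k in atTop, ∀ S : ℕ, reg.L k ≤ S →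
        ∀ (f : Fin Nf) (v : Literature.Probability.LatticeModels.Site 4), v ∈ box 4 S →
          K * (1 + |Real.log (reg.a k)|) ≤ reg.a k * ‖v‖ →
            (∫ U : GaugeConfig 4 (2 * S + 1) (Matrix.specialUnitaryGroup (Fin 3) ℂ),
                ‖(diracMatrix U fun fl => reg.mcrit k + reg.a k * m fl / reg.Zm k).det‖ *
                  (∑ a : Fin 3, ∑ i : Fin 4, ∑ b : Fin 3, ∑ j : Fin 4,
                    ‖(diracMatrix U fun fl => reg.mcrit k + reg.a k * m fl / reg.Zm k)⁻¹
                      (quarkEquiv (f, (Torus.proj (2 * S + 1) 0, a, i)))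
                      (quarkEquiv (f, (Torus.proj (2 * S + 1) (v), b, j)))‖) ^ s
                ∂(wilsonMeasure (fundamentalRep (Fin 3)) (reg.β k))) /
              (∫ U : GaugeConfig 4 (2 * S + 1) (Matrix.specialUnitaryGroup (Fin 3) ℂ),
                ‖(diracMatrix U fun fl => reg.mcrit k + reg.a k * m fl / reg.Zm k).det‖
                ∂(wilsonMeasure (fundamentalRep (Fin 3)) (reg.β k))) ≤
              C * Real.exp (-(δ * (reg.a k * ‖v‖))) := by
  intro Nf reg m hβ hIn
  -- the second hypothesis is `Input Nf reg m`, definitionally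
  obtain ⟨s, δ, C, K₀, ℓ₀, hs0, hs1, hδ, _hC, hwin, -, hdec⟩ :=
    outward_of_localCofactorDomination_farStability_betaFloor hK hF Nf reg m hβ hIn
  refine ⟨s, δ, C, K₀, hs0, hs1, hδ, ?_⟩
  filter_upwards [hwin, hdec] with k hkwin hk S hS f v hv hfar
  have hℓ : (ℓ₀ k f : ℝ) ≤ ‖v‖ := by
    have ha : 0 < reg.a k := reg.a_pos k
    have h1 : (ℓ₀ k f : ℝ) * reg.a k ≤ reg.a k * ‖v‖ := (hkwin f).trans hfar
    nlinarith
  exact hk S hS f v hv hℓ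


/-! ## 3. The coupling floor is automatic under asymptotic scaling -/

/-- `afBeta N_f Λ a_k → +∞` along any `a_k → 0⁺` when `N_f ≤ 16` (`b₀ > 0`): the two-loop profile
`2 b₀ ℓ + 2 (b₁/b₀) log ℓ`, `ℓ = log (1/(a²Λ²)) → ∞`, grows like `2 b₀ ℓ`.
[cite: MontvayMunster1994, §3.3.3 (3.263)–(3.265)] -/
theorem tendsto_afBeta_atTop {Nf : ℕ} (hNf : Nf ≤ 16) {Λ : ℝ} (hΛ : 0 < Λ) {a : ℕ → ℝ}
    (ha : ∀ k, 0 < a k) (ha0 : Tendsto a atTop (𝓝 0)) :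
    Tendsto (fun k => afBeta Nf Λ (a k)) atTop atTop := by
  have hb₀ : 0 < betaCoeff₀ Nf := by
    unfold betaCoeff₀
    have h : (Nf : ℝ) ≤ 16 := by exact_mod_cast hNf
    exact div_pos (by linarith) (by positivity)
  -- the large logarithm `ℓ_k = log (1/(a_k² Λ²)) → +∞`
  obtain ⟨ℓ, hℓ_def⟩ : ∃ ℓ : ℕ → ℝ, ∀ k, ℓ k = Real.log (1 / (a k ^ 2 * Λ ^ 2)) := ⟨_, fun _ => rfl⟩
  have hℓ : Tendsto ℓ atTop atTop := by
    have h1 : Tendsto (fun k => a k ^ 2 * Λ ^ 2) atTop (𝓝[>] 0) := by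
      refine tendsto_nhdsWithin_iff.mpr ⟨?_, Eventually.of_forall fun k => ?_⟩
      · simpa using (ha0.pow 2).mul_const (Λ ^ 2)
      · have := ha k
        show 0 < a k ^ 2 * Λ ^ 2
        positivity
    have h2 := Real.tendsto_log_atTop.comp h1.inv_tendsto_nhdsGT_zero
    refine h2.congr' (Eventually.of_forall fun k => ?_)
    simp [hℓ_def, one_div]
  have hℓpos : ∀ᶠ k in atTop, 0 < ℓ k := hℓ.eventually_gt_atTop 0
  -- `afBeta = ℓ · (2 b₀ + 2 (b₁/b₀) (log ℓ / ℓ))`, second factor `→ 2 b₀ > 0`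
  have hq : Tendsto (fun k => 2 * betaCoeff₀ Nf +
      2 * (betaCoeff₁ Nf / betaCoeff₀ Nf) * (Real.log (ℓ k) / ℓ k)) atTop (𝓝 (2 * betaCoeff₀ Nf)) := by
    have h1 : Tendsto (fun k => Real.log (ℓ k) / ℓ k) atTop (𝓝 0) :=
      Real.isLittleO_log_id_atTop.tendsto_div_nhds_zero.comp hℓ
    have h2 := (h1.const_mul (2 * (betaCoeff₁ Nf / betaCoeff₀ Nf))).const_add (2 * betaCoeff₀ Nf)
    simpa using h2
  have hprod := hℓ.atTop_mul_pos (by positivity : (0 : ℝ) < 2 * betaCoeff₀ Nf) hq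
  refine hprod.congr' ?_
  filter_upwards [hℓpos] with k hk
  rw [afBeta, ← hℓ_def k]
  field_simp

/-- **Under asymptotic scaling with `N_f ≤ 16` the inverse bare couplings diverge**, `β_k → +∞`
(`β_k = afBeta N_f Λ a_k + o(1)`). [cite: MontvayMunster1994, §3.3.3 (3.263)–(3.265)] -/
theorem tendsto_beta_atTop_of_hasAsymptoticScaling {Nf : ℕ} (hNf : Nf ≤ 16) (reg : QCDRegularisation Nf)
    (m : Fin Nf → ℝ) (z shift : QCDField Nf → ℕ → ℝ) (h : (reg.scheme m z shift).HasAsymptoticScaling) :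
    Tendsto reg.β atTop atTop := by
  obtain ⟨Λ, hΛ, hε⟩ := h
  have hA := tendsto_afBeta_atTop hNf hΛ reg.a_pos reg.tendsto_a
  have hε' : ∀ᶠ k in atTop, (-1 : ℝ) ≤ reg.β k - afBeta Nf Λ (reg.a k) := by
    have h1 : ∀ᶠ k in atTop,
        (reg.scheme m z shift).β k - afBeta Nf Λ ((reg.scheme m z shift).a k) ∈ Set.Ioi (-1 : ℝ) :=
      hε (Ioi_mem_nhds (by norm_num))
    filter_upwards [h1] with k hk
    exact le_of_lt hk
  have h2 := tendsto_atTop_add_right_of_le' atTop (-1 : ℝ) hA hε'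
  refine h2.congr' (Eventually.of_forall fun k => ?_)
  show afBeta Nf Λ (reg.a k) + (reg.β k - afBeta Nf Λ (reg.a k)) = reg.β k
  ring

/-- **The coupling floor under asymptotic scaling** (`β₀ = 1`): for `N_f ≤ 16` and any regularisation one of
whose schemes scales asymptotically, `∃ β₀ > 0, ∀ᶠ k, β₀ ≤ |β_k|` — the extra hypothesis of
`closure_from_betaFloor` is discharged by the trajectory item's `HasAsymptoticScaling`. [folklore] -/
theorem betaFloor_of_hasAsymptoticScaling {Nf : ℕ} (hNf : Nf ≤ 16) (reg : QCDRegularisation Nf)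
    (m : Fin Nf → ℝ) (z shift : QCDField Nf → ℕ → ℝ) (h : (reg.scheme m z shift).HasAsymptoticScaling) :
    ∃ β₀ : ℝ, 0 < β₀ ∧ ∀ᶠ k in atTop, β₀ ≤ |reg.β k| :=
  ⟨1, one_pos, ((tendsto_beta_atTop_of_hasAsymptoticScaling hNf reg m z shift h).eventually_ge_atTop 1).mono
    fun _ hk => hk.trans (le_abs_self _)⟩

end Summit.QuantumFields.QCD.Theorems.VonMisesCirclesC2
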